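import Summits.QuantumFields.YangMills.Theses.BalabanLadder
import Summits.QuantumFields.YangMills.Theorems.LatticeGapInUVUnitsXiUnbounded
import Summits.QuantumFields.YangMills.Theorems.BalabanLadderIRRankPurityCofinalDefs
import Summits.QuantumFields.YangMills.Theorems.BalabanLadderIRColdPressurePincerDefs
import Summits.QuantumFields.YangMills.Theorems.ConvexGribovBodyNonSimplyConnectedLatticeGapAdmissibleInstance
import Summits.QuantumFields.YangMills.Theorems.BrascampLiebVacuumSC.Negative.AdmissibleInstance

/-!
# `BalabanLadder.IR` / `IRcof` — the floor `LowerBounds` is load-bearing in the LEAF itself (unconditional)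

Negative-side file (author: ideator `ym-ir-idea-10` gen 5, lens «negation», zero-ask by-product; landed by the LEAD prover
`ym-ir-line-ab-p1` gen 6, content byte-identical to `Cruxes/IR/IRFalseWithoutLowerBounds.lean` d17e356d760d except this compressed
docstring) for the crux items `stmt-QuantumFields-19354` = `Summit.QuantumFields.YangMills.Theses.BalabanLadder.IR` and
`stmt-QuantumFields-26930` = `….BalabanLadder.IRcof` (route `BalabanLadder`, rung R2c).  Both items read
`… → LowerBounds G r a → (clustering at rate c₁ · a(β) per lattice step, volume-uniformly, for all large β / on a cofinal set)`.
THIS FILE: with the hypothesis `LowerBounds G r a` DELETED, both statements are FALSE — unconditionally, witnessed by `SU(2)` in the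
fundamental representation and an explicit slowly decaying STEP unit map.  Hence any proof of `IR` or of `IRcof` consumes
`LowerBounds` quantitatively: it must extract from the floors that `a(β)` decays at least as fast as the inverse lattice correlation
length (`c₁ · a(β) ≤ m(β)` in the plaquette channel) — the items' own clause «rate must scale like a(β) ≍ ξ(β)⁻¹».  The must-use
list of record (census K-v5.4-1) had this for THE NUMBERS `PX` / `PXcof` via the heavy-twist wall (p624174); here it is for the leaf
conclusions `GapInUnits` / cofinal `GapInUnits` themselves, the infrared input being the landed divergence of the lattice correlation length.

## Results (sorry-free)
* `plaquette_clusters_slowly_at_all_large_couplings` — torus, ALL-couplings form of `ξ_lat(β) → ∞` (every compact simple `G`, every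
  `r`): `∀ ε > 0 ∃ β₁ ∀ β ≥ β₁ ∀ S₀ C ∃ S ≥ S₀ ∃ n ≤ S, C e^{−ε n} < |corr_{β,2S+1}(P, P, n)|` (`P` = the `(0,1)`-plaquette); proof =
  the odd-torus limit-state transfer of `LatticeGapInUVUnitsXiUnbounded.lean` (ym-line-cbag-p1) run at every `β ≥ β₁(ε/2)` of the landed
  `xiDiverges_proof` (route `DirichletWindow`, item 8941).
* `exists_step_unit` — for any thresholds `b : ℕ → ℝ` a unit map `a > 0`, `a → 0`, with: `∀ K ∃ B ∀ β ≥ B ∃ j ≥ K, b j ≤ β ∧ a β = 1/(j+1)`.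
* `exists_unit_not_cofinalGap` (MASTER, every compact simple `G`, every `r`): a positive unit map `a → 0` in which even the COFINAL
  `GapInUnits` family fails (`ε_j = 1/(j+1)²`, `b j = β₁(ε_j)`, step unit; at `β ∈ Bset` beyond `β₂` and beyond the `B` of `K = ⌈1/c₁⌉₊`
  the claimed bound `C e^{−c₁ a(β) n}` on all large tori contradicts `b j ≤ β`); `exists_unit_not_gapInUnits` (`Bset = univ`).
* `IR_false_without_LowerBounds`, `IRcof_false_without_LowerBounds` (items 19354 / 26930, witness `SU(2)`), `IRsc_…`, `IRscCof_…`
  (`SU(2)` + tree `simplyConnectedSpace_su2`), `IRnsc_…`, `IRnscCof_…` (N / N_cof of record, witness `SO(3)` via tree `so3_admissible`):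
  each item / half with `LowerBounds G r a →` deleted is FALSE; §5: each floor-free form implies its item by name.

HONEST FRAMING: negative bookkeeping only («what any proof must use»); the weakened statements are strictly STRONGER than the items, so
nothing here refutes `IR`, `IRcof`, `BalabanLadder`, and nothing here proves any clustering; the Yang–Mills mass gap (Clay) is NOT proved
by anything in this tree; R4 closes the conditional finite-𝕋⁴ rung `BalabanLadder.UV` only; IR / IRcof stand 0/1.  Sources: S. Chatterjee,
arXiv:1803.01950, Problem 5.1 (ξ → ∞); E. Seiler, LNP 159 (1982) Ch. 2 (torus limit states); tree: `xiDiverges_proof`, `CriticalityOfXiDiverges.*`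
(DirichletWindowCriticalityOfXiDiverges.lean), `xiUnbounded_of_isCompactSimpleLieGroup` (LatticeGapInUVUnitsXiUnbounded.lean). -/

set_option autoImplicit false

noncomputable section

open MeasureTheory Filter Topology
open Literature.MathematicalPhysics.QuantumFieldTheory
open Literature.MathematicalPhysics.QuantumLattice
open Summit.QuantumFields.YangMills.Cruxes.OSLegsFromFemtoAndGap.DlrCollarTransfer (GapInUnits)
open Summit.QuantumFields.YangMills.Theorems.LatticeGapInUVUnits.Negative (suFund)

namespace Summit.QuantumFields.YangMills.Theorems.IR.Negative

/-! ## 1. The torus, all-couplings form of `ξ_lat → ∞` -/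

section Gauge

variable {G : Type} [Group G] [TopologicalSpace G] [IsTopologicalGroup G] [CompactSpace G]
  [MeasurableSpace G] [BorelSpace G]

/-- **The plaquette pair clusters arbitrarily slowly at ALL large couplings** (torus form of `ξ_lat(β) → ∞`, every
compact simple `G`, every lattice representation `r`): for every `ε > 0` there is `β₁` such that for every `β ≥ β₁`,
every `S₀` and every `C` there are an odd torus `2S+1`, `S ≥ S₀`, and a separation `n ≤ S` with
`C · e^{−ε n} < |⟨P · τ_n P⟩ − ⟨P⟩⟨P⟩|_{β, 2S+1}`.  Otherwise an odd-torus limit state at `β` would have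
`f_β(n e₀) ≤ C e^{−ε n}`, against the landed floor `f_β(n e₀) ≥ A e^{−m n}`, `A > 0`, `m ≤ ε/2`, of `xiDiverges_proof`.
[cite: arXiv180301950, Problem 5.1] -/
theorem plaquette_clusters_slowly_at_all_large_couplings (hG : IsCompactSimpleLieGroup G) (r : LatticeRep G)
    {ε : ℝ} (hε : 0 < ε) :
    ∃ β₁ : ℝ, ∀ β : ℝ, β₁ ≤ β → ∀ (S₀ : ℕ) (C : ℝ), ∃ S : ℕ, S₀ ≤ S ∧ ∃ n : ℕ, n ≤ S ∧
      C * Real.exp (-(ε * n)) <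
        |latticeConnectedCorr r.ρ β (2 * S + 1) (plaquetteObs r.ρ 0 0 1) (plaquetteObs r.ρ 0 0 1) n| := by
  haveI : SecondCountableTopology G :=
    (r.continuous.isClosedEmbedding r.injective).isEmbedding.secondCountableTopology
  haveI : T2Space G := (r.continuous.isClosedEmbedding r.injective).isEmbedding.t2Space
  obtain ⟨β₁, hβ₁⟩ := xiDiverges_proof G hG r (ε / 2) (half_pos hε)
  refine ⟨β₁, fun β hβ S₀ C => ?_⟩
  by_contra hcon
  push Not at hcon
  obtain ⟨μ, φ, hφ, hμ⟩ :=
    CriticalityOfXiDiverges.exists_isInfiniteVolumeLimitAlong_odd (d := 4) r.ρ r.continuous β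
  have hμmem : μ ∈ infiniteVolumeLimitPoints (d := 4) r.ρ β :=
    ⟨fun k => 2 * φ k, fun _ _ hab => by dsimp only; have := hφ hab; omega, hμ⟩
  obtain ⟨m', A', hA', -, hm'le, hlow⟩ := hβ₁ β hβ μ hμmem
  have hup : ∀ n : ℕ, plaquetteCorrFn r.ρ μ ((n : ℤ) • Pi.single (0 : Fin 4) (1 : ℤ)) ≤
      C * Real.exp (-(ε * n)) := fun n =>
    CriticalityOfXiDiverges.plaquetteCorrFn_le_of_abs_latticeConnectedCorr_le r.ρ r.continuous hφ hμ
      (S₀ := S₀) (fun S hS hn => hcon S hS n hn)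
  exact CriticalityOfXiDiverges.false_of_exp_lower_le_upper hA' (by linarith) fun n => (hlow n).trans (hup n)

end Gauge

/-! ## 2. Slow step units -/

/-- **Slow step unit maps.** Given arbitrary thresholds `b : ℕ → ℝ`, there is a unit map `a : ℝ → ℝ` with
`0 < a` and `a → 0` at `+∞` such that for every `K : ℕ` all sufficiently large `β` have `a β = 1/(j+1)` for some
index `j ≥ K` whose threshold is passed, `b j ≤ β`.  (Take `b' j = max (j+1) (max_{i ≤ j} b i)`, `J(β)` = the
largest `j ≤ ⌊β⌋₊` with `b' j ≤ β`, and `a β = 1/(J(β)+1)`.) [folklore] -/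
theorem exists_step_unit (b : ℕ → ℝ) :
    ∃ a : ℝ → ℝ, (∀ β, 0 < a β) ∧ Tendsto a atTop (𝓝 0) ∧
      ∀ K : ℕ, ∃ B : ℝ, ∀ β : ℝ, B ≤ β → ∃ j : ℕ, K ≤ j ∧ b j ≤ β ∧ a β = 1 / ((j : ℝ) + 1) := by
  classical
  -- a monotone majorant of the thresholds, growing at least linearly
  let b' : ℕ → ℝ := fun j => max ((j : ℝ) + 1) ((Finset.range (j + 1)).sup' ⟨0, by simp⟩ b)
  have hb'_ge_b : ∀ j, b j ≤ b' j := fun j =>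
    (Finset.le_sup' b (by simp : j ∈ Finset.range (j + 1))).trans (le_max_right _ _)
  have hb'_ge_lin : ∀ j : ℕ, (j : ℝ) + 1 ≤ b' j := fun j => le_max_left _ _
  -- the index of `β`: the largest `j ≤ ⌊β⌋₊` whose majorised threshold is passed
  let J : ℝ → ℕ := fun β => Nat.findGreatest (fun j => b' j ≤ β) ⌊β⌋₊
  have hJ : ∀ (K : ℕ) (β : ℝ), b' K ≤ β → K ≤ J β ∧ b' (J β) ≤ β := by
    intro K β hK
    have hKβ : (K : ℝ) ≤ β := by linarith [hb'_ge_lin K]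
    have hKle : K ≤ ⌊β⌋₊ := Nat.le_floor hKβ
    exact ⟨Nat.le_findGreatest hKle hK, Nat.findGreatest_spec (P := fun j => b' j ≤ β) hKle hK⟩
  refine ⟨fun β => 1 / ((J β : ℝ) + 1), fun β => by positivity, ?_, ?_⟩
  · -- `a → 0`: beyond `b' K` the index is `≥ K`, so `a ≤ 1/(K+1)`
    refine Metric.tendsto_atTop.2 fun δ hδ => ?_
    obtain ⟨K, hK⟩ := exists_nat_gt (1 / δ)
    refine ⟨b' K, fun β hβ => ?_⟩
    have hKJ : (K : ℝ) ≤ J β := by exact_mod_cast (hJ K β hβ).1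
    rw [Real.dist_eq, sub_zero, abs_of_pos (by positivity)]
    rw [div_lt_iff₀ (by positivity)]
    rw [div_lt_iff₀ hδ] at hK
    nlinarith
  · intro K
    exact ⟨b' K, fun β hβ => ⟨J β, (hJ K β hβ).1, (hb'_ge_b _).trans (hJ K β hβ).2, rfl⟩⟩

/-! ## 3. In a suitable unit the cofinal `GapInUnits` family fails — every compact simple `G` -/

section Master

variable {G : Type} [Group G] [TopologicalSpace G] [IsTopologicalGroup G] [CompactSpace G]
  [MeasurableSpace G] [BorelSpace G]

/-- **Master lemma: for every compact simple `G` and every lattice representation `r` there is a positive unit map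
`a → 0` in which even the COFINAL `GapInUnits` family fails** (no cofinal `Bset`, rate `c₁ a(β)`, volume threshold
`S₁`, one constant per pair).  The unit: the slow step unit of `exists_step_unit` adapted to the thresholds
`b j = β₁(1/(j+1)²)` of `plaquette_clusters_slowly_at_all_large_couplings`; a cofinal `Bset` with clustering at rate
`c₁ a(β)` would contain a coupling `β` with `a β = 1/(j+1)`, `1/(j+1) ≤ c₁`, `b j ≤ β`, at which the plaquette pair
clusters more slowly than `e^{−n/(j+1)²} ≥ e^{−c₁ a(β) n}` on some large odd torus. [cite: arXiv180301950, Problem 5.1] -/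
theorem exists_unit_not_cofinalGap (hG : IsCompactSimpleLieGroup G) (r : LatticeRep G) :
    ∃ a : ℝ → ℝ, (∀ β, 0 < a β) ∧ Tendsto a atTop (𝓝 0) ∧
      ¬ ∃ Bset : Set ℝ, (∀ x : ℝ, ∃ β ∈ Bset, x ≤ β) ∧ ∃ (c₁ β₂ : ℝ) (S₁ : ℝ → ℕ), 0 < c₁ ∧
          ∀ A B : YMSpecies G, ∃ C : ℝ, ∀ β ∈ Bset, β₂ ≤ β → ∀ S n : ℕ, S₁ β ≤ S → n ≤ S →
            |latticeConnectedCorr r.ρ β (2 * S + 1) A.F B.F n| ≤ C * Real.exp (-(c₁ * a β * n)) := by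
  haveI : SecondCountableTopology G :=
    (r.continuous.isClosedEmbedding r.injective).isEmbedding.secondCountableTopology
  -- thresholds `b j := β₁(ε_j)`, `ε_j = 1/(j+1)²`, and the adapted slow step unit
  have hε : ∀ j : ℕ, (0 : ℝ) < 1 / ((j : ℝ) + 1) ^ 2 := fun j => by positivity
  choose b hb using fun j : ℕ => plaquette_clusters_slowly_at_all_large_couplings hG r (hε j)
  obtain ⟨a, ha, hlim, hstep⟩ := exists_step_unit b
  refine ⟨a, ha, hlim, ?_⟩
  rintro ⟨Bset, hcof, c₁, β₂, S₁, hc₁, hAB⟩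
  -- the claimed bound for the plaquette pair
  obtain ⟨C, hC⟩ := hAB (plaquetteObservable (d := 4) r.ρ r.continuous 0 1)
    (plaquetteObservable (d := 4) r.ρ r.continuous 0 1)
  -- a coupling in `Bset`, beyond `β₂`, whose index `j` has `1/(j+1) ≤ c₁` and `b j ≤ β`
  obtain ⟨B, hB⟩ := hstep ⌈1 / c₁⌉₊
  obtain ⟨β, hβmem, hβge⟩ := hcof (max B β₂)
  obtain ⟨j, hKj, hbj, haj⟩ := hB β ((le_max_left _ _).trans hβge)
  have hjc : 1 / ((j : ℝ) + 1) ≤ c₁ := by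
    have h1 : 1 / c₁ ≤ (j : ℝ) := (Nat.le_ceil _).trans (by exact_mod_cast hKj)
    rw [div_le_iff₀ hc₁] at h1
    rw [div_le_iff₀ (by positivity)]
    nlinarith
  -- the slow torus at `β` for rate `ε_j`, against the constant `max C 0`
  obtain ⟨S, hS, n, hn, hlt⟩ := hb j β hbj (S₁ β) (max C 0)
  have hup := hC β hβmem ((le_max_right _ _).trans hβge) S n hS hn
  simp only [plaquetteObservable_F] at hup
  have hrate : 1 / ((j : ℝ) + 1) ^ 2 * n ≤ c₁ * a β * n := by
    refine mul_le_mul_of_nonneg_right ?_ (Nat.cast_nonneg n)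
    rw [haj]
    calc 1 / ((j : ℝ) + 1) ^ 2 = 1 / ((j : ℝ) + 1) * (1 / ((j : ℝ) + 1)) := by
          rw [sq, one_div_mul_one_div]
      _ ≤ c₁ * (1 / ((j : ℝ) + 1)) := mul_le_mul_of_nonneg_right hjc (by positivity)
  have hchain : C * Real.exp (-(c₁ * a β * n)) ≤ max C 0 * Real.exp (-(1 / ((j : ℝ) + 1) ^ 2 * n)) :=
    calc C * Real.exp (-(c₁ * a β * n)) ≤ max C 0 * Real.exp (-(c₁ * a β * n)) :=
          mul_le_mul_of_nonneg_right (le_max_left _ _) (Real.exp_pos _).le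
      _ ≤ max C 0 * Real.exp (-(1 / ((j : ℝ) + 1) ^ 2 * n)) :=
          mul_le_mul_of_nonneg_left (Real.exp_le_exp.2 (by linarith)) (le_max_right _ _)
  exact lt_irrefl _ (hlt.trans_le (hup.trans hchain))

/-- The all-couplings family `GapInUnits G r a` is the cofinal family on `Bset = univ`; so in the unit of
`exists_unit_not_cofinalGap` also `GapInUnits G r a` fails. [folklore] -/
theorem exists_unit_not_gapInUnits (hG : IsCompactSimpleLieGroup G) (r : LatticeRep G) :
    ∃ a : ℝ → ℝ, (∀ β, 0 < a β) ∧ Tendsto a atTop (𝓝 0) ∧ ¬ GapInUnits G r a := by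
  obtain ⟨a, ha, hlim, hnot⟩ := exists_unit_not_cofinalGap hG r
  refine ⟨a, ha, hlim, fun hgap => hnot ?_⟩
  obtain ⟨c₁, β₂, S₁, hc₁, hAB⟩ := hgap
  refine ⟨Set.univ, fun x => ⟨x, Set.mem_univ _, le_rfl⟩, c₁, β₂, S₁, hc₁, fun A B => ?_⟩
  obtain ⟨C, hC⟩ := hAB A B
  exact ⟨C, fun β _ hβ S n hS hn => hC β hβ S n hS hn⟩

end Master

/-! ## 4. The items and their halves, with the floor deleted, are FALSE

The six statements below are `BalabanLadder.IR` (19354), `BalabanLadder.IRcof` (26930), and their simply-connected /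
non-simply-connected halves `ColdPressurePincer.IRsc`, `ColdPressurePincer.IRnsc` (N of record), `RankPurity.IRscCof`,
`RankPurity.IRnscCof` (N_cof — the registered stub `stub_irnscCof` of the 26930 slot `Cruxes/IRcof/Lines/
pinned_cofinal_bill.lean`), each with the hypothesis `LowerBounds G r a →` deleted and otherwise verbatim, written
INLINE (no named `Prop` for a statement proved false).  Witness groups: `SU(2)` (simply connected, tree
`simplyConnectedSpace_su2`) and `SO(3)` (not simply connected, tree `so3_admissible`), Borel σ-algebra. -/

section SU2

/-- `SU(2)` is compact simple (= the tree's `OSLegsFromFemtoAndGap.Negative.isCompactSimpleLieGroup_su2`; private copy, imports kept small). -/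
private theorem su2_isCompactSimpleLieGroup : IsCompactSimpleLieGroup (Matrix.specialUnitaryGroup (Fin 2) ℂ) :=
  isCompactSimpleLieGroup_specialUnitaryGroup isSimpleCompactGroup_specialUnitaryGroup_holds le_rfl

/-- **`IRcof` without `LowerBounds` is FALSE** (the floor is load-bearing in the cofinal leaf, item
stmt-QuantumFields-26930), witnessed by `SU(2)` in the fundamental representation and the unit of
`exists_unit_not_cofinalGap`.  So every proof of `IRcof` uses the floors to pin the decay of `a` to the inverse
lattice correlation length. [cite: arXiv180301950, Problem 5.1] -/
theorem IRcof_false_without_LowerBounds :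
    ¬ (∀ (G : Type) [Group G] [TopologicalSpace G] [IsTopologicalGroup G] [CompactSpace G],
        IsCompactSimpleLieGroup G →
        letI : MeasurableSpace G := borel G
        haveI : BorelSpace G := ⟨rfl⟩
        ∀ (r : LatticeRep G) (a : ℝ → ℝ), (∀ β, 0 < a β) → Filter.Tendsto a Filter.atTop (nhds 0) →
          ∃ Bset : Set ℝ, (∀ x : ℝ, ∃ β ∈ Bset, x ≤ β) ∧ ∃ (c₁ β₂ : ℝ) (S₁ : ℝ → ℕ), 0 < c₁ ∧
            ∀ A B : YMSpecies G, ∃ C : ℝ, ∀ β ∈ Bset, β₂ ≤ β → ∀ S n : ℕ, S₁ β ≤ S → n ≤ S →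
              |latticeConnectedCorr r.ρ β (2 * S + 1) A.F B.F n| ≤ C * Real.exp (-(c₁ * a β * n))) := by
  intro h
  letI : MeasurableSpace (Matrix.specialUnitaryGroup (Fin 2) ℂ) := borel _
  haveI : BorelSpace (Matrix.specialUnitaryGroup (Fin 2) ℂ) := ⟨rfl⟩
  obtain ⟨a, ha, hlim, hnot⟩ := exists_unit_not_cofinalGap su2_isCompactSimpleLieGroup (suFund 2)
  exact hnot (h _ su2_isCompactSimpleLieGroup (suFund 2) a ha hlim)

/-- **`IR` without `LowerBounds` is FALSE** (the floor is load-bearing in the leaf, item stmt-QuantumFields-19354):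
«for every compact simple `G`, every lattice representation and EVERY positive unit map `a → 0`, `GapInUnits G r a`»
fails at `SU(2)`.  Reading: `GapInUnits G r a` says `ξ_lat(β) · a(β) = O(1)`; since `ξ_lat → ∞` is a theorem and
`a` is free, only the floors can exclude units with `a(β) ξ_lat(β) → ∞`. [cite: arXiv180301950, Problem 5.1] -/
theorem IR_false_without_LowerBounds :
    ¬ (∀ (G : Type) [Group G] [TopologicalSpace G] [IsTopologicalGroup G] [CompactSpace G],
        IsCompactSimpleLieGroup G →
        letI : MeasurableSpace G := borel G
        haveI : BorelSpace G := ⟨rfl⟩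
        ∀ (r : LatticeRep G) (a : ℝ → ℝ), (∀ β, 0 < a β) → Filter.Tendsto a Filter.atTop (nhds 0) →
          GapInUnits G r a) := by
  intro h
  letI : MeasurableSpace (Matrix.specialUnitaryGroup (Fin 2) ℂ) := borel _
  haveI : BorelSpace (Matrix.specialUnitaryGroup (Fin 2) ℂ) := ⟨rfl⟩
  obtain ⟨a, ha, hlim, hnot⟩ := exists_unit_not_gapInUnits su2_isCompactSimpleLieGroup (suFund 2)
  exact hnot (h _ su2_isCompactSimpleLieGroup (suFund 2) a ha hlim)

/-- **`IRscCof` (the simply-connected conjunct of the cofinal leaf) without `LowerBounds` is FALSE**, witnessed by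
`SU(2)` (simply connected: tree `simplyConnectedSpace_su2`). [cite: arXiv180301950, Problem 5.1] -/
theorem IRscCof_false_without_LowerBounds :
    ¬ (∀ (G : Type) [Group G] [TopologicalSpace G] [IsTopologicalGroup G] [CompactSpace G],
        IsCompactSimpleLieGroup G → SimplyConnectedSpace G →
        letI : MeasurableSpace G := borel G
        haveI : BorelSpace G := ⟨rfl⟩
        ∀ (r : LatticeRep G) (a : ℝ → ℝ), (∀ β, 0 < a β) → Filter.Tendsto a Filter.atTop (nhds 0) →
          ∃ Bset : Set ℝ, (∀ x : ℝ, ∃ β ∈ Bset, x ≤ β) ∧ ∃ (c₁ β₂ : ℝ) (S₁ : ℝ → ℕ), 0 < c₁ ∧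
            ∀ A B : YMSpecies G, ∃ C : ℝ, ∀ β ∈ Bset, β₂ ≤ β → ∀ S n : ℕ, S₁ β ≤ S → n ≤ S →
              |latticeConnectedCorr r.ρ β (2 * S + 1) A.F B.F n| ≤ C * Real.exp (-(c₁ * a β * n))) := by
  intro h
  letI : MeasurableSpace (Matrix.specialUnitaryGroup (Fin 2) ℂ) := borel _
  haveI : BorelSpace (Matrix.specialUnitaryGroup (Fin 2) ℂ) := ⟨rfl⟩
  obtain ⟨a, ha, hlim, hnot⟩ := exists_unit_not_cofinalGap su2_isCompactSimpleLieGroup (suFund 2)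
  exact hnot (h _ su2_isCompactSimpleLieGroup
    Summit.QuantumFields.YangMills.Theorems.BrascampLiebVacuumSC.Negative.simplyConnectedSpace_su2
    (suFund 2) a ha hlim)

/-- **`IRsc` (the simply-connected half of `IR`) without `LowerBounds` is FALSE**, witnessed by `SU(2)`.
[cite: arXiv180301950, Problem 5.1] -/
theorem IRsc_false_without_LowerBounds :
    ¬ (∀ (G : Type) [Group G] [TopologicalSpace G] [IsTopologicalGroup G] [CompactSpace G],
        IsCompactSimpleLieGroup G → SimplyConnectedSpace G →
        letI : MeasurableSpace G := borel G
        haveI : BorelSpace G := ⟨rfl⟩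
        ∀ (r : LatticeRep G) (a : ℝ → ℝ), (∀ β, 0 < a β) → Filter.Tendsto a Filter.atTop (nhds 0) →
          GapInUnits G r a) := by
  intro h
  letI : MeasurableSpace (Matrix.specialUnitaryGroup (Fin 2) ℂ) := borel _
  haveI : BorelSpace (Matrix.specialUnitaryGroup (Fin 2) ℂ) := ⟨rfl⟩
  obtain ⟨a, ha, hlim, hnot⟩ := exists_unit_not_gapInUnits su2_isCompactSimpleLieGroup (suFund 2)
  exact hnot (h _ su2_isCompactSimpleLieGroup
    Summit.QuantumFields.YangMills.Theorems.BrascampLiebVacuumSC.Negative.simplyConnectedSpace_su2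
    (suFund 2) a ha hlim)

end SU2

section SO3

open Literature.AlgebraicTopology.FundamentalGroup (SO3)
open Summit.QuantumFields.YangMills.Theorems.NonSimplyConnectedLatticeGap
  (so3_isTopologicalGroup so3_compactSpace isCompactSimpleLieGroup_SO3 not_simplyConnectedSpace_SO3
    nonempty_latticeRep_SO3)

/-- **`IRnscCof` (N_cof — the `π₁(G) ≠ 1` conjunct of the cofinal leaf, the registered stub `stub_irnscCof` of the
26930 slot of record) without `LowerBounds` is FALSE**, witnessed by `SO(3)` (compact simple, not simply connected,
with a lattice representation — tree `so3_admissible`, `nonempty_latticeRep_SO3`) and the unit of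
`exists_unit_not_cofinalGap`.  So every proof of N_cof, too, uses the floors quantitatively (besides the flux-sector
structure recorded on its card). [cite: arXiv180301950, Problem 5.1] -/
theorem IRnscCof_false_without_LowerBounds :
    ¬ (∀ (G : Type) [Group G] [TopologicalSpace G] [IsTopologicalGroup G] [CompactSpace G],
        IsCompactSimpleLieGroup G → ¬ SimplyConnectedSpace G →
        letI : MeasurableSpace G := borel G
        haveI : BorelSpace G := ⟨rfl⟩
        ∀ (r : LatticeRep G) (a : ℝ → ℝ), (∀ β, 0 < a β) → Filter.Tendsto a Filter.atTop (nhds 0) →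
          ∃ Bset : Set ℝ, (∀ x : ℝ, ∃ β ∈ Bset, x ≤ β) ∧ ∃ (c₁ β₂ : ℝ) (S₁ : ℝ → ℕ), 0 < c₁ ∧
            ∀ A B : YMSpecies G, ∃ C : ℝ, ∀ β ∈ Bset, β₂ ≤ β → ∀ S n : ℕ, S₁ β ≤ S → n ≤ S →
              |latticeConnectedCorr r.ρ β (2 * S + 1) A.F B.F n| ≤ C * Real.exp (-(c₁ * a β * n))) := by
  intro h
  haveI : IsTopologicalGroup SO3 := so3_isTopologicalGroup
  haveI : CompactSpace SO3 := so3_compactSpace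
  letI : MeasurableSpace SO3 := borel _
  haveI : BorelSpace SO3 := ⟨rfl⟩
  obtain ⟨r⟩ := nonempty_latticeRep_SO3
  have hG : IsCompactSimpleLieGroup SO3 := isCompactSimpleLieGroup_SO3
  obtain ⟨a, ha, hlim, hnot⟩ := exists_unit_not_cofinalGap hG r
  exact hnot (h SO3 hG not_simplyConnectedSpace_SO3 r a ha hlim)

/-- **`IRnsc` (N — the `π₁(G) ≠ 1` half of `IR`) without `LowerBounds` is FALSE**, witnessed by `SO(3)`.
[cite: arXiv180301950, Problem 5.1] -/
theorem IRnsc_false_without_LowerBounds :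
    ¬ (∀ (G : Type) [Group G] [TopologicalSpace G] [IsTopologicalGroup G] [CompactSpace G],
        IsCompactSimpleLieGroup G → ¬ SimplyConnectedSpace G →
        letI : MeasurableSpace G := borel G
        haveI : BorelSpace G := ⟨rfl⟩
        ∀ (r : LatticeRep G) (a : ℝ → ℝ), (∀ β, 0 < a β) → Filter.Tendsto a Filter.atTop (nhds 0) →
          GapInUnits G r a) := by
  intro h
  haveI : IsTopologicalGroup SO3 := so3_isTopologicalGroup
  haveI : CompactSpace SO3 := so3_compactSpace
  letI : MeasurableSpace SO3 := borel _
  haveI : BorelSpace SO3 := ⟨rfl⟩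
  obtain ⟨r⟩ := nonempty_latticeRep_SO3
  have hG : IsCompactSimpleLieGroup SO3 := isCompactSimpleLieGroup_SO3
  obtain ⟨a, ha, hlim, hnot⟩ := exists_unit_not_gapInUnits hG r
  exact hnot (h SO3 hG not_simplyConnectedSpace_SO3 r a ha hlim)

end SO3

/-! ## 5. The deletions are weakenings of the hypotheses (so §4 says «must use», not «refuted») -/

/-- The floor-free form implies the item `IR` (by name). [folklore] -/
theorem IR_of_floorFree
    (h : ∀ (G : Type) [Group G] [TopologicalSpace G] [IsTopologicalGroup G] [CompactSpace G],
        IsCompactSimpleLieGroup G →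
        letI : MeasurableSpace G := borel G
        haveI : BorelSpace G := ⟨rfl⟩
        ∀ (r : LatticeRep G) (a : ℝ → ℝ), (∀ β, 0 < a β) → Filter.Tendsto a Filter.atTop (nhds 0) →
          GapInUnits G r a) :
    Summit.QuantumFields.YangMills.Theses.BalabanLadder.IR :=
  fun G _ _ _ _ hG r a ha hlim _ => h G hG r a ha hlim

/-- The floor-free cofinal form implies the item `IRcof` (by name). [folklore] -/
theorem IRcof_of_floorFree
    (h : ∀ (G : Type) [Group G] [TopologicalSpace G] [IsTopologicalGroup G] [CompactSpace G],
        IsCompactSimpleLieGroup G →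
        letI : MeasurableSpace G := borel G
        haveI : BorelSpace G := ⟨rfl⟩
        ∀ (r : LatticeRep G) (a : ℝ → ℝ), (∀ β, 0 < a β) → Filter.Tendsto a Filter.atTop (nhds 0) →
          ∃ Bset : Set ℝ, (∀ x : ℝ, ∃ β ∈ Bset, x ≤ β) ∧ ∃ (c₁ β₂ : ℝ) (S₁ : ℝ → ℕ), 0 < c₁ ∧
            ∀ A B : YMSpecies G, ∃ C : ℝ, ∀ β ∈ Bset, β₂ ≤ β → ∀ S n : ℕ, S₁ β ≤ S → n ≤ S →
              |latticeConnectedCorr r.ρ β (2 * S + 1) A.F B.F n| ≤ C * Real.exp (-(c₁ * a β * n))) :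
    Summit.QuantumFields.YangMills.Theses.BalabanLadder.IRcof :=
  fun G _ _ _ _ hG r a ha hlim _ => h G hG r a ha hlim

/-- The floor-free nsc cofinal form implies `RankPurity.IRnscCof` (N_cof, by name). [folklore] -/
theorem IRnscCof_of_floorFree
    (h : ∀ (G : Type) [Group G] [TopologicalSpace G] [IsTopologicalGroup G] [CompactSpace G],
        IsCompactSimpleLieGroup G → ¬ SimplyConnectedSpace G →
        letI : MeasurableSpace G := borel G
        haveI : BorelSpace G := ⟨rfl⟩
        ∀ (r : LatticeRep G) (a : ℝ → ℝ), (∀ β, 0 < a β) → Filter.Tendsto a Filter.atTop (nhds 0) →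
          ∃ Bset : Set ℝ, (∀ x : ℝ, ∃ β ∈ Bset, x ≤ β) ∧ ∃ (c₁ β₂ : ℝ) (S₁ : ℝ → ℕ), 0 < c₁ ∧
            ∀ A B : YMSpecies G, ∃ C : ℝ, ∀ β ∈ Bset, β₂ ≤ β → ∀ S n : ℕ, S₁ β ≤ S → n ≤ S →
              |latticeConnectedCorr r.ρ β (2 * S + 1) A.F B.F n| ≤ C * Real.exp (-(c₁ * a β * n))) :
    Summit.QuantumFields.YangMills.Cruxes.IR.RankPurity.IRnscCof :=
  fun G _ _ _ _ hG hπ r a ha hlim _ => h G hG hπ r a ha hlim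

/-- The floor-free sc cofinal form implies `RankPurity.IRscCof` (by name). [folklore] -/
theorem IRscCof_of_floorFree
    (h : ∀ (G : Type) [Group G] [TopologicalSpace G] [IsTopologicalGroup G] [CompactSpace G],
        IsCompactSimpleLieGroup G → SimplyConnectedSpace G →
        letI : MeasurableSpace G := borel G
        haveI : BorelSpace G := ⟨rfl⟩
        ∀ (r : LatticeRep G) (a : ℝ → ℝ), (∀ β, 0 < a β) → Filter.Tendsto a Filter.atTop (nhds 0) →
          ∃ Bset : Set ℝ, (∀ x : ℝ, ∃ β ∈ Bset, x ≤ β) ∧ ∃ (c₁ β₂ : ℝ) (S₁ : ℝ → ℕ), 0 < c₁ ∧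
            ∀ A B : YMSpecies G, ∃ C : ℝ, ∀ β ∈ Bset, β₂ ≤ β → ∀ S n : ℕ, S₁ β ≤ S → n ≤ S →
              |latticeConnectedCorr r.ρ β (2 * S + 1) A.F B.F n| ≤ C * Real.exp (-(c₁ * a β * n))) :
    Summit.QuantumFields.YangMills.Cruxes.IR.RankPurity.IRscCof :=
  fun G _ _ _ _ hG hπ r a ha hlim _ => h G hG hπ r a ha hlim

/-- The floor-free nsc form implies `ColdPressurePincer.IRnsc` (N of record, by name). [folklore] -/
theorem IRnsc_of_floorFree
    (h : ∀ (G : Type) [Group G] [TopologicalSpace G] [IsTopologicalGroup G] [CompactSpace G],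
        IsCompactSimpleLieGroup G → ¬ SimplyConnectedSpace G →
        letI : MeasurableSpace G := borel G
        haveI : BorelSpace G := ⟨rfl⟩
        ∀ (r : LatticeRep G) (a : ℝ → ℝ), (∀ β, 0 < a β) → Filter.Tendsto a Filter.atTop (nhds 0) →
          GapInUnits G r a) :
    Summit.QuantumFields.YangMills.Cruxes.IR.ColdPressurePincer.IRnsc :=
  fun G _ _ _ _ hG hπ r a ha hlim _ => h G hG hπ r a ha hlim

end Summit.QuantumFields.YangMills.Theorems.IR.Negative
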